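/-
Copyright (c) 2026. All rights reserved.
Released under Apache 2.0 license as described in the file LICENSE.
-/
import Literature.AlgebraicGeometry.ComplexMultiplication.HyperellipticJacobianLevelSixtyJacobian
import HarnessLib

/-!
# GGL 2024 Thm. 3.0 + Lemma 14 at a level `m = 8p`, `p ≥ 7` prime: `J_{8p} ∼ X_4 × Y_8² × X_p² × Y_{4p}² × Y_{8p}²` has
# `End⁰(J_{8p}) ≅ ℚ(i) × Mat₂(ℚ(√−2)) × Mat₂(ℚ(ζ_p)) × Mat₂(ℚ(ζ_{4p} − ζ_{4p}⁻¹)) × Mat₂(ℚ(ζ_{8p} − ζ_{8p}⁻¹))`, of dimension `16p − 6`,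
# and `dim J_{8p} = 4p − 1`

Layer `Literature/AlgebraicGeometry/ComplexMultiplication`, namespace `…ComplexMultiplication.HyperellipticJacobian`; the sequel of
`HyperellipticJacobianFourTimesPrimeLevel` (F13: `J_{4p}`), assembled from `HyperellipticJacobianCrossLevelOrthogonality` (F12: orthogonality
through the reflex fields), `HyperellipticJacobianEndomorphismAlgebras` (F9: Lemma 14), `HyperellipticJacobianLevelSixtyJacobian` (F20:
`hom_eq_zero_vecCons`, the `ℚ(ζ_p)`-block `X_p ⊕ X_{2p}`).  THEOREMS ONLY (no definition, no named fact, no `sorry`, no instance).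

## The print

A. Gallese, H. Goodson, D. Lombardo, arXiv:2405.20394 [GalleseGoodsonLombardo2024] (held `paper:arxiv-2405.20394`, p0012, p0015 read first-hand):
THM. 3.0 «`J_m ∼ ∏_{d ∣ m, d ≠ 1,2} X_d`», (4) «`X_{2p} ∼ X_p`», (5) «`X_d ∼ Y_d²`, CM by `ℚ(ζ_d − ζ_d⁻¹)`» for `4 ∣ d ∉ {20, 24, 60}`, and the last
statement «all `X_d` with odd `d` and all `Y_d` are pairwise non-isogenous»; §3.5 LEMMA 14 and the sentence following it.  For `m = 8p`, `p` prime,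
the divisors `d ∉ {1, 2}` are `4, 8, p, 2p, 4p, 8p`; for `p ≥ 7` none of `8, 4p, 8p` is exceptional and the ten orthogonality relations all hold:
`X_4 ⟂ Y_8, Y_{8p}` (`i ∉ K*` when `8 ∣ d`), `X_4 ⟂ Y_{4p}` (degrees `2 ≠ p − 1`, F13), `X_4, Y_8, Y_{4p}, Y_{8p} ⟂ X_p, X_{2p}` (roots of unity of
order `p`), `Y_8 ⟂ Y_{4p}`, `Y_{8p} ⟂ Y_{4p}` (`i ∈ K*(Φ_{4p})` as `4p ≡ 4 (mod 8)`, `i ∉ K*(Φ_8), K*(Φ_{8p})`), `Y_8 ⟂ Y_{8p}` (degrees `2 ≠ 2(p − 1)`).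
Hence `End⁰(J_{8p}) ≅ ℚ(i) × Mat₂(ℚ(ζ_8 − ζ_8⁻¹)) × Mat₂(ℚ(ζ_p)) × Mat₂(ℚ(ζ_{4p} − ζ_{4p}⁻¹)) × Mat₂(ℚ(ζ_{8p} − ζ_{8p}⁻¹))`, of dimension
`2 + 8 + 4(p − 1) + 4(p − 1) + 8(p − 1) = 16p − 6`; `dim J_{8p} = 1 + 2 + (p − 1) + (p − 1) + 2(p − 1) = 4p − 1 = g(C_{8p})`.
(`p = 3` is the exceptional level `24`, F18; at `p = 5` the divisor `20` is exceptional.)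

## The carrier

`![A₄, A₈, A ⊕ A₂, A′, A″]` over `Fin 5`: realisations of the lower-half types of `ℚ(ζ_4)` (any type), `ℚ(ζ_8)`, `ℚ(ζ_p) ∕ ℚ(ζ_{2p})`, `ℚ(ζ_{4p})`,
`ℚ(ζ_{8p})`.

## What is proved

`orthogonal_eight_fourDvd_of_not_eight_dvd` (`Y_8 ⟂ Y_d` for `d ≡ 4 (mod 8)`, `d ≥ 12` non-exceptional), `orthogonal_eight_fourDvd_of_totient_ne_four`
(`Y_8 ⟂ Y_d` when `φ(d) ≠ 4`), **`hom_eq_zero_blocks_eightTimesPrime`** (the five blocks are pairwise orthogonal),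
**`nonempty_endAlgebra_algEquiv_eightTimesPrime`** (`End⁰(J) ≃ₐ[ℚ] K₄ × (Mat₂(ℚ(ζ_8 − ζ_8⁻¹)) × (Mat₂(K) × (Mat₂(ℚ(ζ_{4p} − ζ_{4p}⁻¹)) ×
Mat₂(ℚ(ζ_{8p} − ζ_{8p}⁻¹)))))`), **`finrank_endAlgebra_eightTimesPrime`** (`dim_ℚ = 16p − 6`, `dim J = 4p − 1`).

## Honest column ∕ NOT here

The curve; `J_{40}` (`p = 5`, the exceptional divisor `20`); levels `16p`, `4p^k`; `Y_d` vs `Y_{d′}` with `φ(d) = φ(d′)`, `d ≡ d′ (mod 8)`.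
`HC_CM` is not touched.

## References

* [GalleseGoodsonLombardo2024] arXiv:2405.20394 — §3 Thm. 3.0 ((4), (5), last statement), §3.5 Lemma 14 and the sentence following it.
* [MumfordAV1970] D. Mumford — §19 Thm. 3 Cor. 1–2, p. 174.
* [Shimura1998] G. Shimura — §5.1 Prop. 3, Prop. 6, §8.3 Prop. 28.
* [MilneCM2006] J. S. Milne — Ch. I §1 Prop. 1.18 (c), §3 Prop. 3.13.

## Provenance

Cell `pub-hodgecm2` (COR-CM), KEPT Literature lane `lit-deligne-3` gen 52 (claim GGL24-EIGHT-TIMES-PRIME; count-neutral, own lane).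
-/

noncomputable section

open CategoryTheory CategoryTheory.Limits NumberField Module

namespace Literature.AlgebraicGeometry.ComplexMultiplication

open Literature.AlgebraicGeometry.Motives
open Literature.AlgebraicGeometry.HodgeTheory (complexBetti)
open Literature.NumberTheory.ComplexMultiplication

namespace HyperellipticJacobian

open Literature.AlgebraicGeometry.Pohlmann1968 Literature.AlgebraicGeometry.Pohlmann1968.Cyclotomic

/-! ## §1 `Y_8` against the other `Y_d` -/

section Eight

variable {K₈ : Type} [Field K₈] [NumberField K₈] [IsCyclotomicExtension {8} ℚ K₈] {Φ₈ : CMType K₈}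
  {A₈ : AbelianVariety ℂ} {ι₈ : 𝓞 K₈ →+* End A₈} {θ₈ : K₈ →+* Module.End ℂ (complexBetti A₈.X 1)}
  {d : ℕ} [NeZero d] {Kd : Type} [Field Kd] [NumberField Kd] [IsCyclotomicExtension {d} ℚ Kd] {Φd : CMType Kd}
  {Ad : AbelianVariety ℂ} {ιd : 𝓞 Kd →+* End Ad} {θd : Kd →+* Module.End ℂ (complexBetti Ad.X 1)}

/-- **`Y_8 ⟂ Y_d` for `d ≡ 4 (mod 8)`, `d ≥ 12`, `d ∉ {20, 60}`** — e.g. `Y_8 ⟂ Y_{4p}` for `p ≥ 7` prime (`i ∉ K*(Φ_8) = ℚ(√−2)`, `i ∈ K*(Φ_d)`).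
[cite: GalleseGoodsonLombardo2024, §3 Thm. 3.0 (last statement)] [cite: MilneCM2006, Ch. I §1 Prop. 1.18 (c) and §3 Prop. 3.13] -/
theorem orthogonal_eight_fourDvd_of_not_eight_dvd (hΦ₈ : ∀ σ : K₈ →+* ℂ, σ ∈ Φ₈.1 ↔ 2 * (expOf 8 K₈ σ).val < 8)
    (hA₈ : IsCMTypeRealisation Φ₈ A₈ ι₈ θ₈) (h4 : 4 ∣ d) (h8 : 8 ≤ d) (h20 : d ≠ 20) (h60 : d ≠ 60) (h8n : ¬ 8 ∣ d)
    (hΦd : ∀ σ : Kd →+* ℂ, σ ∈ Φd.1 ↔ 2 * (expOf d Kd σ).val < d) (hAd : IsCMTypeRealisation Φd Ad ιd θd) :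
    (∀ u : A₈ ⟶ Ad, u = 0) ∧ (∀ v : Ad ⟶ A₈, v = 0) ∧
      ¬ AbelianVariety.IsIsogenous A₈ Ad ∧ ¬ AbelianVariety.IsIsogenous Ad A₈ :=
  orthogonal_fourDvd_of_eight_dvd_of_not_eight_dvd (dvd_refl 8) (by norm_num) hΦ₈ hA₈ h4 h8 h20 h60 h8n hΦd hAd

/-- **`Y_8 ⟂ Y_d` for `4 ∣ d ≥ 8`, `d ∉ {20, 24, 60}` with `φ(d) ≠ 4`** — e.g. `Y_8 ⟂ Y_{8p}` for `p ≥ 7` prime (reflex degrees `2 ≠ φ(d)/2`).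
[cite: GalleseGoodsonLombardo2024, §3 Thm. 3.0 (last statement)] [cite: MilneCM2006, Ch. I §1 Prop. 1.18 (c) and §3 Prop. 3.13] -/
theorem orthogonal_eight_fourDvd_of_totient_ne_four (hΦ₈ : ∀ σ : K₈ →+* ℂ, σ ∈ Φ₈.1 ↔ 2 * (expOf 8 K₈ σ).val < 8)
    (hA₈ : IsCMTypeRealisation Φ₈ A₈ ι₈ θ₈) (h4 : 4 ∣ d) (h8 : 8 ≤ d) (h20 : d ≠ 20) (h24 : d ≠ 24) (h60 : d ≠ 60)
    (hφ : Nat.totient d ≠ 4) (hΦd : ∀ σ : Kd →+* ℂ, σ ∈ Φd.1 ↔ 2 * (expOf d Kd σ).val < d) (hAd : IsCMTypeRealisation Φd Ad ιd θd) :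
    (∀ u : A₈ ⟶ Ad, u = 0) ∧ (∀ v : Ad ⟶ A₈, v = 0) ∧
      ¬ AbelianVariety.IsIsogenous A₈ Ad ∧ ¬ AbelianVariety.IsIsogenous Ad A₈ :=
  orthogonal_fourDvd_of_totient_ne ⟨2, rfl⟩ le_rfl (by norm_num) (by norm_num) (by norm_num) hΦ₈ hA₈ h4 h8 h20 h24 h60 hΦd hAd
    (by rw [show Nat.totient 8 = 4 by decide +kernel]; exact fun h => hφ h.symm)

end Eight

/-! ## §2 The five blocks of `J_{8p}` are pairwise orthogonal -/

section EightTimesPrime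

variable {p : ℕ} [NeZero p] [NeZero (2 * p)] [NeZero (4 * p)] [NeZero (8 * p)]
  {K₄ : Type} [Field K₄] [NumberField K₄] [IsCyclotomicExtension {4} ℚ K₄] {Φ₄ : CMType K₄}
  {A₄ : AbelianVariety ℂ} {ι₄ : 𝓞 K₄ →+* End A₄} {θ₄ : K₄ →+* Module.End ℂ (complexBetti A₄.X 1)}
  {K₈ : Type} [Field K₈] [NumberField K₈] [IsCyclotomicExtension {8} ℚ K₈] {Φ₈ : CMType K₈}
  {A₈ : AbelianVariety ℂ} {ι₈ : 𝓞 K₈ →+* End A₈} {θ₈ : K₈ →+* Module.End ℂ (complexBetti A₈.X 1)}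
  {K : Type} [Field K] [NumberField K] [IsCyclotomicExtension {p} ℚ K] {Φ : CMType K}
  {A : AbelianVariety ℂ} {ι : 𝓞 K →+* End A} {θ : K →+* Module.End ℂ (complexBetti A.X 1)}
  {L : Type} [Field L] [NumberField L] [IsCyclotomicExtension {2 * p} ℚ L] {Ψ : CMType L}
  {A₂ : AbelianVariety ℂ} {ι₂ : 𝓞 L →+* End A₂} {θ₂ : L →+* Module.End ℂ (complexBetti A₂.X 1)}
  {K' : Type} [Field K'] [NumberField K'] [IsCyclotomicExtension {4 * p} ℚ K'] {Φ' : CMType K'}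
  {A' : AbelianVariety ℂ} {ι' : 𝓞 K' →+* End A'} {θ' : K' →+* Module.End ℂ (complexBetti A'.X 1)}
  {K'' : Type} [Field K''] [NumberField K''] [IsCyclotomicExtension {8 * p} ℚ K''] {Φ'' : CMType K''}
  {A'' : AbelianVariety ℂ} {ι'' : 𝓞 K'' →+* End A''} {θ'' : K'' →+* Module.End ℂ (complexBetti A''.X 1)}

omit [NeZero p] [NeZero (2 * p)] [NeZero (4 * p)] [NeZero (8 * p)] in
/-- Arithmetic of the levels `4p`, `8p` for `p ≥ 7` prime: `φ(4p) = 2(p − 1)`, `φ(8p) = 4(p − 1)`, `8 ∤ 4p`, and neither level is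
exceptional. [folklore] -/
private theorem totient_eight_mul_prime (hp : p.Prime) (h7 : 7 ≤ p) :
    (Nat.totient (4 * p) = 2 * (p - 1) ∧ 8 ≤ 4 * p ∧ 4 * p ≠ 20 ∧ 4 * p ≠ 24 ∧ 4 * p ≠ 60 ∧ ¬ 8 ∣ 4 * p) ∧
    (Nat.totient (8 * p) = 4 * (p - 1) ∧ 8 ≤ 8 * p ∧ 8 * p ≠ 20 ∧ 8 * p ≠ 24 ∧ 8 * p ≠ 60) := by
  have hodd : Odd p := hp.odd_of_ne_two (by omega)
  have hcop4 : Nat.Coprime 4 p := by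
    have h := (Nat.coprime_two_left.2 hodd).pow_left 2
    simpa using h
  have hcop8 : Nat.Coprime 8 p := by
    have h := (Nat.coprime_two_left.2 hodd).pow_left 3
    simpa using h
  have h15 : p ≠ 15 := by rintro rfl; exact absurd hp (by norm_num)
  have h8n : ¬ 8 ∣ 4 * p := by
    obtain ⟨k, hk⟩ := hodd
    omega
  refine ⟨⟨?_, by omega, by omega, by omega, by omega, h8n⟩, ⟨?_, by omega, by omega, by omega, by omega⟩⟩
  · rw [Nat.totient_mul hcop4, Nat.totient_prime hp, show Nat.totient 4 = 2 by decide +kernel]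
  · rw [Nat.totient_mul hcop8, Nat.totient_prime hp, show Nat.totient 8 = 4 by decide +kernel]

/-- **The blocks `X_4`, `X_8`, `X_p ⊕ X_{2p}`, `X_{4p}`, `X_{8p}` of `J_{8p}` (`p ≥ 7` prime) are pairwise orthogonal**: every homomorphism
between two distinct members of `![A₄, A₈, A ⊕ A₂, A′, A″]` vanishes (the ten relations of the module docstring, F12 ∕ F13 ∕ §1, assembled
with F20's `hom_eq_zero_vecCons`). [cite: GalleseGoodsonLombardo2024, §3 Thm. 3.0 (last statement) and §3.5 (after Lemma 14)]
[cite: MilneCM2006, Ch. I §3 Prop. 3.13] -/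
theorem hom_eq_zero_blocks_eightTimesPrime (hp : p.Prime) (h7 : 7 ≤ p) (hA₄ : IsCMTypeRealisation Φ₄ A₄ ι₄ θ₄)
    (hΦ₈ : ∀ σ : K₈ →+* ℂ, σ ∈ Φ₈.1 ↔ 2 * (expOf 8 K₈ σ).val < 8) (hA₈ : IsCMTypeRealisation Φ₈ A₈ ι₈ θ₈)
    (hΦ : ∀ σ : K →+* ℂ, σ ∈ Φ.1 ↔ 2 * (expOf p K σ).val < p) (hA : IsCMTypeRealisation Φ A ι θ)
    (hΨ : ∀ σ : L →+* ℂ, σ ∈ Ψ.1 ↔ 2 * (expOf (2 * p) L σ).val < 2 * p) (hA₂ : IsCMTypeRealisation Ψ A₂ ι₂ θ₂)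
    (hΦ' : ∀ σ : K' →+* ℂ, σ ∈ Φ'.1 ↔ 2 * (expOf (4 * p) K' σ).val < 4 * p) (hA' : IsCMTypeRealisation Φ' A' ι' θ')
    (hΦ'' : ∀ σ : K'' →+* ℂ, σ ∈ Φ''.1 ↔ 2 * (expOf (8 * p) K'' σ).val < 8 * p) (hA'' : IsCMTypeRealisation Φ'' A'' ι'' θ'') :
    ∀ i j : Fin 5, i ≠ j →
      ∀ f : (![A₄, A₈, ⨁ fun l : Fin 2 => (![A, A₂] : Fin 2 → AbelianVariety ℂ) l, A', A''] : Fin 5 → AbelianVariety ℂ) i ⟶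
        (![A₄, A₈, ⨁ fun l : Fin 2 => (![A, A₂] : Fin 2 → AbelianVariety ℂ) l, A', A''] : Fin 5 → AbelianVariety ℂ) j, f = 0 := by
  have hodd : Odd p := hp.odd_of_ne_two (by omega)
  have h3 : 3 ≤ p := by omega
  obtain ⟨⟨hφ4, h8, h20, h24, h60, h8n⟩, ⟨hφ8, h8', h20', h24', h60'⟩⟩ := totient_eight_mul_prime hp h7
  have h4 : 4 ∣ 4 * p := dvd_mul_right 4 p
  have h4' : 4 ∣ 8 * p := ⟨2 * p, by ring⟩
  have h88 : 8 ∣ 8 * p := dvd_mul_right 8 p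
  -- the ten relations
  have o48 := orthogonal_four_fourDvd_of_eight_dvd hA₄ (dvd_refl 8) (by norm_num) hΦ₈ hA₈
  have oA4 := orthogonal_odd_four (Φ' := Φ₄) hodd h3 hΦ hA hA₄
  have oA₂4 := orthogonal_twiceOdd_four (Φ' := Φ₄) hodd h3 hΨ hA₂ hA₄
  have o4' := orthogonal_four_fourTimesPrime hp h7 hA₄ hΦ' hA'
  have o4'' := orthogonal_four_fourDvd_of_eight_dvd hA₄ h88 h24' hΦ'' hA''
  have oA8 := orthogonal_odd_fourDvd hodd h3 hΦ hA ⟨2, rfl⟩ le_rfl (by norm_num) (by norm_num) (by norm_num) hΦ₈ hA₈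
  have oA₂8 := orthogonal_twiceOdd_fourDvd hodd h3 hΨ hA₂ ⟨2, rfl⟩ le_rfl (by norm_num) (by norm_num) (by norm_num) hΦ₈ hA₈
  have o8' := orthogonal_eight_fourDvd_of_not_eight_dvd hΦ₈ hA₈ h4 h8 h20 h60 h8n hΦ' hA'
  have o8'' := orthogonal_eight_fourDvd_of_totient_ne_four hΦ₈ hA₈ h4' h8' h20' h24' h60' (by rw [hφ8]; omega) hΦ'' hA''
  have oA' := orthogonal_odd_fourDvd hodd h3 hΦ hA h4 h8 h20 h24 h60 hΦ' hA'
  have oA₂' := orthogonal_twiceOdd_fourDvd hodd h3 hΨ hA₂ h4 h8 h20 h24 h60 hΦ' hA'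
  have oA'' := orthogonal_odd_fourDvd hodd h3 hΦ hA h4' h8' h20' h24' h60' hΦ'' hA''
  have oA₂'' := orthogonal_twiceOdd_fourDvd hodd h3 hΨ hA₂ h4' h8' h20' h24' h60' hΦ'' hA''
  have o''' := orthogonal_fourDvd_of_eight_dvd_of_not_eight_dvd h88 h24' hΦ'' hA'' h4 h8 h20 h60 h8n hΦ' hA'
  -- block-level relations
  have b01 : (∀ u : A₄ ⟶ A₈, u = 0) ∧ (∀ v : A₈ ⟶ A₄, v = 0) := ⟨o48.1, o48.2.1⟩
  have b02 : (∀ u : A₄ ⟶ ⨁ fun l : Fin 2 => (![A, A₂] : Fin 2 → AbelianVariety ℂ) l, u = 0) ∧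
      (∀ v : (⨁ fun l : Fin 2 => (![A, A₂] : Fin 2 → AbelianVariety ℂ) l) ⟶ A₄, v = 0) :=
    ⟨fun u => hom_to_pair_eq_zero oA4.2.1 oA₂4.2.1 u, fun v => hom_from_pair_eq_zero oA4.1 oA₂4.1 v⟩
  have b03 : (∀ u : A₄ ⟶ A', u = 0) ∧ (∀ v : A' ⟶ A₄, v = 0) := ⟨o4'.1, o4'.2.1⟩
  have b04 : (∀ u : A₄ ⟶ A'', u = 0) ∧ (∀ v : A'' ⟶ A₄, v = 0) := ⟨o4''.1, o4''.2.1⟩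
  have b12 : (∀ u : A₈ ⟶ ⨁ fun l : Fin 2 => (![A, A₂] : Fin 2 → AbelianVariety ℂ) l, u = 0) ∧
      (∀ v : (⨁ fun l : Fin 2 => (![A, A₂] : Fin 2 → AbelianVariety ℂ) l) ⟶ A₈, v = 0) :=
    ⟨fun u => hom_to_pair_eq_zero oA8.2.1 oA₂8.2.1 u, fun v => hom_from_pair_eq_zero oA8.1 oA₂8.1 v⟩
  have b13 : (∀ u : A₈ ⟶ A', u = 0) ∧ (∀ v : A' ⟶ A₈, v = 0) := ⟨o8'.1, o8'.2.1⟩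
  have b14 : (∀ u : A₈ ⟶ A'', u = 0) ∧ (∀ v : A'' ⟶ A₈, v = 0) := ⟨o8''.1, o8''.2.1⟩
  have b23 : (∀ u : (⨁ fun l : Fin 2 => (![A, A₂] : Fin 2 → AbelianVariety ℂ) l) ⟶ A', u = 0) ∧
      (∀ v : A' ⟶ ⨁ fun l : Fin 2 => (![A, A₂] : Fin 2 → AbelianVariety ℂ) l, v = 0) :=
    ⟨fun u => hom_from_pair_eq_zero oA'.1 oA₂'.1 u, fun v => hom_to_pair_eq_zero oA'.2.1 oA₂'.2.1 v⟩
  have b24 : (∀ u : (⨁ fun l : Fin 2 => (![A, A₂] : Fin 2 → AbelianVariety ℂ) l) ⟶ A'', u = 0) ∧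
      (∀ v : A'' ⟶ ⨁ fun l : Fin 2 => (![A, A₂] : Fin 2 → AbelianVariety ℂ) l, v = 0) :=
    ⟨fun u => hom_from_pair_eq_zero oA''.1 oA₂''.1 u, fun v => hom_to_pair_eq_zero oA''.2.1 oA₂''.2.1 v⟩
  have b34 : (∀ u : A' ⟶ A'', u = 0) ∧ (∀ v : A'' ⟶ A', v = 0) := ⟨o'''.2.1, o'''.1⟩
  -- assemble by induction on the list of blocks (F20)
  have g3 := hom_eq_zero_vecCons (X := A') (F := (![A''] : Fin 1 → AbelianVariety ℂ)) (Fin.cons b34 finZeroElim)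
    hom_eq_zero_of_fin_one
  have g2 := hom_eq_zero_vecCons (X := ⨁ fun l : Fin 2 => (![A, A₂] : Fin 2 → AbelianVariety ℂ) l)
    (F := (![A', A''] : Fin 2 → AbelianVariety ℂ)) (Fin.cons b23 (Fin.cons b24 finZeroElim)) g3
  have g1 := hom_eq_zero_vecCons (X := A₈)
    (F := (![⨁ fun l : Fin 2 => (![A, A₂] : Fin 2 → AbelianVariety ℂ) l, A', A''] : Fin 3 → AbelianVariety ℂ))
    (Fin.cons b12 (Fin.cons b13 (Fin.cons b14 finZeroElim))) g2
  exact hom_eq_zero_vecCons (X := A₄)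
    (F := (![A₈, ⨁ fun l : Fin 2 => (![A, A₂] : Fin 2 → AbelianVariety ℂ) l, A', A''] : Fin 4 → AbelianVariety ℂ))
    (Fin.cons b01 (Fin.cons b02 (Fin.cons b03 (Fin.cons b04 finZeroElim)))) g1

/-! ## §3 `End⁰(J_{8p})`, of dimension `16p − 6`; `dim J_{8p} = 4p − 1` -/

omit [IsCyclotomicExtension {4} ℚ K₄] in
/-- `[ℚ(ζ_4) : ℚ] = 2`. [folklore] -/
private theorem finrank_eq_two_four_e [IsCyclotomicExtension {4} ℚ K₄] : finrank ℚ K₄ = 2 := by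
  rw [finrank_eq_totient 4 K₄]
  decide +kernel

/-- The product of five algebras indexed by `Fin 5` (`∏_{i : Fin 5} T_i ≃ₐ T₀ × (T₁ × (T₂ × (T₃ × T₄)))`). [folklore] -/
private theorem nonempty_pi_fin_five_algEquiv_prod (T : Fin 5 → Type) [∀ i, Ring (T i)] [∀ i, Algebra ℚ (T i)] :
    Nonempty ((∀ i, T i) ≃ₐ[ℚ] T 0 × (T 1 × (T 2 × (T 3 × T 4)))) := by
  refine ⟨AlgEquiv.ofBijective
    ((Pi.evalAlgHom ℚ T 0).prod ((Pi.evalAlgHom ℚ T 1).prod ((Pi.evalAlgHom ℚ T 2).prod ((Pi.evalAlgHom ℚ T 3).prod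
      (Pi.evalAlgHom ℚ T 4)))))
    ⟨fun f g h => ?_, fun x => ?_⟩⟩
  · simp only [AlgHom.prod_apply, Pi.evalAlgHom_apply, Prod.mk.injEq] at h
    funext i
    match i with
    | ⟨0, _⟩ => exact h.1
    | ⟨1, _⟩ => exact h.2.1
    | ⟨2, _⟩ => exact h.2.2.1
    | ⟨3, _⟩ => exact h.2.2.2.1
    | ⟨4, _⟩ => exact h.2.2.2.2
  · exact ⟨Fin.cons x.1 (Fin.cons x.2.1 (Fin.cons x.2.2.1 (Fin.cons x.2.2.2.1 (Fin.cons x.2.2.2.2 finZeroElim)))), rfl⟩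

/-- **GGL THM. 3.0 + LEMMA 14 at the level `8p`, `p ≥ 7` prime:
`End⁰(J_{8p}) ≃ₐ[ℚ] ℚ(ζ_4) × (Mat₂(ℚ(ζ_8 − ζ_8⁻¹)) × (Mat₂(ℚ(ζ_p)) × (Mat₂(ℚ(ζ_{4p} − ζ_{4p}⁻¹)) × Mat₂(ℚ(ζ_{8p} − ζ_{8p}⁻¹)))))`** on the carrier
`⨁_{Fin 5} ![A₄, A₈, A ⊕ A₂, A′, A″]`: the blocks are pairwise orthogonal (§2), so `End⁰` is the product of the blocks' `End⁰` (Mumford §19 Cor. 2);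
`End⁰(A₄) = ℚ(ζ_4)` (every type of `ℚ(i)` is primitive), `End⁰(A₈) ≅ Mat₂(ℚ(ζ_8 − ζ_8⁻¹))`, `End⁰(A ⊕ A₂) ≅ Mat₂(ℚ(ζ_p))` (F20),
`End⁰(A′) ≅ Mat₂(ℚ(ζ_{4p} − ζ_{4p}⁻¹))`, `End⁰(A″) ≅ Mat₂(ℚ(ζ_{8p} − ζ_{8p}⁻¹))` (Lemma 14 (2), F9).
[cite: GalleseGoodsonLombardo2024, §3.5 Lemma 14 and the sentence following it; §3 Thm. 3.0 (4), (5), last statement]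
[cite: MumfordAV1970, §19 Cor. 2 of Thm. 3 and p. 174] [cite: Shimura1998, §5.1 Prop. 3 (proof) and Prop. 6] -/
theorem nonempty_endAlgebra_algEquiv_eightTimesPrime (hp : p.Prime) (h7 : 7 ≤ p)
    (hA₄ : IsCMTypeRealisation Φ₄ A₄ ι₄ θ₄)
    (hΦ₈ : ∀ σ : K₈ →+* ℂ, σ ∈ Φ₈.1 ↔ 2 * (expOf 8 K₈ σ).val < 8) (hA₈ : IsCMTypeRealisation Φ₈ A₈ ι₈ θ₈)
    (hΦ : ∀ σ : K →+* ℂ, σ ∈ Φ.1 ↔ 2 * (expOf p K σ).val < p) (hA : IsCMTypeRealisation Φ A ι θ)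
    (hΨ : ∀ σ : L →+* ℂ, σ ∈ Ψ.1 ↔ 2 * (expOf (2 * p) L σ).val < 2 * p) (hA₂ : IsCMTypeRealisation Ψ A₂ ι₂ θ₂)
    (hΦ' : ∀ σ : K' →+* ℂ, σ ∈ Φ'.1 ↔ 2 * (expOf (4 * p) K' σ).val < 4 * p) (hA' : IsCMTypeRealisation Φ' A' ι' θ')
    (hΦ'' : ∀ σ : K'' →+* ℂ, σ ∈ Φ''.1 ↔ 2 * (expOf (8 * p) K'' σ).val < 8 * p) (hA'' : IsCMTypeRealisation Φ'' A'' ι'' θ'') :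
    Nonempty ((⨁ fun i : Fin 5 =>
        (![A₄, A₈, ⨁ fun l : Fin 2 => (![A, A₂] : Fin 2 → AbelianVariety ℂ) l, A', A''] : Fin 5 → AbelianVariety ℂ) i).endAlgebra ≃ₐ[ℚ]
      K₄ × (Matrix (Fin 2) (Fin 2) (IntermediateField.adjoin ℚ {zetaOf 8 K₈ - (zetaOf 8 K₈)⁻¹}) × (Matrix (Fin 2) (Fin 2) K ×
        (Matrix (Fin 2) (Fin 2) (IntermediateField.adjoin ℚ {zetaOf (4 * p) K' - (zetaOf (4 * p) K')⁻¹}) ×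
          Matrix (Fin 2) (Fin 2) (IntermediateField.adjoin ℚ {zetaOf (8 * p) K'' - (zetaOf (8 * p) K'')⁻¹}))))) := by
  classical
  have hodd : Odd p := hp.odd_of_ne_two (by omega)
  have h3 : 3 ≤ p := by omega
  obtain ⟨⟨-, h8, h20, h24, h60, -⟩, ⟨-, h8', h20', h24', h60'⟩⟩ := totient_eight_mul_prime hp h7
  obtain ⟨E, -⟩ := AbelianVariety.nonempty_algEquiv_endAlgebra_biproduct_pi
    (A := fun i : Fin 5 => (![A₄, A₈, ⨁ fun l : Fin 2 => (![A, A₂] : Fin 2 → AbelianVariety ℂ) l, A', A''] : Fin 5 → AbelianVariety ℂ) i)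
    (hom_eq_zero_blocks_eightTimesPrime hp h7 hA₄ hΦ₈ hA₈ hΦ hA hΨ hA₂ hΦ' hA' hΦ'' hA'')
  obtain ⟨P⟩ := nonempty_pi_fin_five_algEquiv_prod
    (fun i : Fin 5 => ((![A₄, A₈, ⨁ fun l : Fin 2 => (![A, A₂] : Fin 2 → AbelianVariety ℂ) l, A', A''] : Fin 5 → AbelianVariety ℂ) i).endAlgebra)
  obtain ⟨e₀⟩ : Nonempty (A₄.endAlgebra ≃ₐ[ℚ] K₄) :=
    hA₄.nonempty_endAlgebra_algEquiv_of_primitive (CMTypeLattice.primitive_of_finrank_eq_two Φ₄ finrank_eq_two_four_e)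
  obtain ⟨-, ⟨e₁⟩, -⟩ := nonempty_matrix_two_algEquiv_endAlgebra_of_four_dvd ⟨2, rfl⟩ le_rfl (by norm_num) (by norm_num) (by norm_num)
    Φ₈ hΦ₈ hA₈
  obtain ⟨e₂⟩ := nonempty_endAlgebra_odd_twiceOdd_algEquiv_matrix hodd h3 hΦ hA hΨ hA₂
  obtain ⟨-, ⟨e₃⟩, -⟩ := nonempty_matrix_two_algEquiv_endAlgebra_of_four_dvd (dvd_mul_right 4 p) h8 h20 h24 h60 Φ' hΦ' hA'
  obtain ⟨-, ⟨e₄⟩, -⟩ := nonempty_matrix_two_algEquiv_endAlgebra_of_four_dvd ⟨2 * p, by ring⟩ h8' h20' h24' h60' Φ'' hΦ'' hA''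
  exact ⟨(E.trans P).trans (AlgEquiv.prodCongr e₀ (AlgEquiv.prodCongr e₁.symm (AlgEquiv.prodCongr e₂ (AlgEquiv.prodCongr e₃.symm e₄.symm))))⟩

/-- **`dim_ℚ End⁰(J_{8p}) = 16p − 6` and `dim J_{8p} = 4p − 1 = g(C_{8p})`** (`p ≥ 7` prime; `2 + 8 + 4(p−1) + 4(p−1) + 8(p−1)`, resp.
`1 + 2 + (p−1) + (p−1) + 2(p−1)`). [cite: GalleseGoodsonLombardo2024, §3 Thm. 3.0 («dim X_d = φ(d)/2») and §3.5 Lemma 14]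
[cite: MumfordAV1970, §19 Cor. 2 of Thm. 3] -/
theorem finrank_endAlgebra_eightTimesPrime (hp : p.Prime) (h7 : 7 ≤ p)
    (hA₄ : IsCMTypeRealisation Φ₄ A₄ ι₄ θ₄)
    (hΦ₈ : ∀ σ : K₈ →+* ℂ, σ ∈ Φ₈.1 ↔ 2 * (expOf 8 K₈ σ).val < 8) (hA₈ : IsCMTypeRealisation Φ₈ A₈ ι₈ θ₈)
    (hΦ : ∀ σ : K →+* ℂ, σ ∈ Φ.1 ↔ 2 * (expOf p K σ).val < p) (hA : IsCMTypeRealisation Φ A ι θ)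
    (hΨ : ∀ σ : L →+* ℂ, σ ∈ Ψ.1 ↔ 2 * (expOf (2 * p) L σ).val < 2 * p) (hA₂ : IsCMTypeRealisation Ψ A₂ ι₂ θ₂)
    (hΦ' : ∀ σ : K' →+* ℂ, σ ∈ Φ'.1 ↔ 2 * (expOf (4 * p) K' σ).val < 4 * p) (hA' : IsCMTypeRealisation Φ' A' ι' θ')
    (hΦ'' : ∀ σ : K'' →+* ℂ, σ ∈ Φ''.1 ↔ 2 * (expOf (8 * p) K'' σ).val < 8 * p) (hA'' : IsCMTypeRealisation Φ'' A'' ι'' θ'') :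
    finrank ℚ (⨁ fun i : Fin 5 =>
        (![A₄, A₈, ⨁ fun l : Fin 2 => (![A, A₂] : Fin 2 → AbelianVariety ℂ) l, A', A''] : Fin 5 → AbelianVariety ℂ) i).endAlgebra =
      16 * p - 6 ∧
    (⨁ fun i : Fin 5 =>
        (![A₄, A₈, ⨁ fun l : Fin 2 => (![A, A₂] : Fin 2 → AbelianVariety ℂ) l, A', A''] : Fin 5 → AbelianVariety ℂ) i).dim = 4 * p - 1 := by
  classical
  have hodd : Odd p := hp.odd_of_ne_two (by omega)
  have h3 : 3 ≤ p := by omega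
  obtain ⟨⟨hφ4, h8, h20, h24, h60, -⟩, ⟨hφ8, h8', h20', h24', h60'⟩⟩ := totient_eight_mul_prime hp h7
  have h4 : 4 ∣ 4 * p := dvd_mul_right 4 p
  have h4' : 4 ∣ 8 * p := ⟨2 * p, by ring⟩
  -- the degrees of the fields
  have hK : finrank ℚ K = p - 1 := by rw [finrank_eq_totient p K, Nat.totient_prime hp]
  have hK' : finrank ℚ K' = 2 * (p - 1) := by rw [finrank_eq_totient (4 * p) K', hφ4]
  have hK'' : finrank ℚ K'' = 4 * (p - 1) := by rw [finrank_eq_totient (8 * p) K'', hφ8]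
  have hK₈ : finrank ℚ K₈ = 4 := by rw [finrank_eq_totient 8 K₈]; decide +kernel
  have hF₈ : finrank ℚ (IntermediateField.adjoin ℚ {zetaOf 8 K₈ - (zetaOf 8 K₈)⁻¹}) = 2 := by
    obtain ⟨K₁, Φ₁, h₁, hp₁, -⟩ :=
      exists_primitive_inducedCMType_index_two_of_four_dvd ⟨2, rfl⟩ le_rfl (by norm_num) (by norm_num) (by norm_num) Φ₈ hΦ₈
    obtain ⟨-, -, -, -, -, -, -, hdeg, hK₁⟩ :=
      eq_fixedField_and_eq_adjoin_of_primitive_of_four_dvd ⟨2, rfl⟩ le_rfl (by norm_num) (by norm_num) (by norm_num) Φ₈ hΦ₈ Φ₁ h₁ hp₁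
    rw [← hK₁]
    rw [show Nat.totient 8 = 4 by decide +kernel] at hdeg
    omega
  have hF' : finrank ℚ (IntermediateField.adjoin ℚ {zetaOf (4 * p) K' - (zetaOf (4 * p) K')⁻¹}) = p - 1 := by
    obtain ⟨K₁, Φ₁, h₁, hp₁, -⟩ := exists_primitive_inducedCMType_index_two_of_four_dvd h4 h8 h20 h24 h60 Φ' hΦ'
    obtain ⟨-, -, -, -, -, -, -, hdeg, hK₁⟩ := eq_fixedField_and_eq_adjoin_of_primitive_of_four_dvd h4 h8 h20 h24 h60 Φ' hΦ' Φ₁ h₁ hp₁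
    rw [← hK₁]
    omega
  have hF'' : finrank ℚ (IntermediateField.adjoin ℚ {zetaOf (8 * p) K'' - (zetaOf (8 * p) K'')⁻¹}) = 2 * (p - 1) := by
    obtain ⟨K₁, Φ₁, h₁, hp₁, -⟩ := exists_primitive_inducedCMType_index_two_of_four_dvd h4' h8' h20' h24' h60' Φ'' hΦ''
    obtain ⟨-, -, -, -, -, -, -, hdeg, hK₁⟩ :=
      eq_fixedField_and_eq_adjoin_of_primitive_of_four_dvd h4' h8' h20' h24' h60' Φ'' hΦ'' Φ₁ h₁ hp₁
    rw [← hK₁]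
    omega
  refine ⟨?_, ?_⟩
  · obtain ⟨e⟩ := nonempty_endAlgebra_algEquiv_eightTimesPrime hp h7 hA₄ hΦ₈ hA₈ hΦ hA hΨ hA₂ hΦ' hA' hΦ'' hA''
    haveI : FiniteDimensional ℚ (IntermediateField.adjoin ℚ {zetaOf 8 K₈ - (zetaOf 8 K₈)⁻¹}) := IntermediateField.finiteDimensional_left _
    haveI : FiniteDimensional ℚ (IntermediateField.adjoin ℚ {zetaOf (4 * p) K' - (zetaOf (4 * p) K')⁻¹}) :=
      IntermediateField.finiteDimensional_left _
    haveI : FiniteDimensional ℚ (IntermediateField.adjoin ℚ {zetaOf (8 * p) K'' - (zetaOf (8 * p) K'')⁻¹}) :=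
      IntermediateField.finiteDimensional_left _
    -- finiteness and freeness of the factors and of the nested products, bottom-up
    haveI : Module.Finite ℚ (Matrix (Fin 2) (Fin 2) (IntermediateField.adjoin ℚ {zetaOf (8 * p) K'' - (zetaOf (8 * p) K'')⁻¹})) :=
      Module.Finite.matrix
    haveI : Module.Finite ℚ (Matrix (Fin 2) (Fin 2) (IntermediateField.adjoin ℚ {zetaOf (4 * p) K' - (zetaOf (4 * p) K')⁻¹})) :=
      Module.Finite.matrix
    haveI : Module.Finite ℚ (Matrix (Fin 2) (Fin 2) K) := Module.Finite.matrix
    haveI : Module.Finite ℚ (Matrix (Fin 2) (Fin 2) (IntermediateField.adjoin ℚ {zetaOf 8 K₈ - (zetaOf 8 K₈)⁻¹})) := Module.Finite.matrix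
    haveI : Module.Free ℚ (Matrix (Fin 2) (Fin 2) (IntermediateField.adjoin ℚ {zetaOf (8 * p) K'' - (zetaOf (8 * p) K'')⁻¹})) :=
      inferInstance
    haveI : Module.Free ℚ (Matrix (Fin 2) (Fin 2) (IntermediateField.adjoin ℚ {zetaOf (4 * p) K' - (zetaOf (4 * p) K')⁻¹})) :=
      inferInstance
    haveI : Module.Free ℚ (Matrix (Fin 2) (Fin 2) K) := inferInstance
    haveI : Module.Free ℚ (Matrix (Fin 2) (Fin 2) (IntermediateField.adjoin ℚ {zetaOf 8 K₈ - (zetaOf 8 K₈)⁻¹})) := inferInstance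
    haveI : Module.Finite ℚ (Matrix (Fin 2) (Fin 2) (IntermediateField.adjoin ℚ {zetaOf (4 * p) K' - (zetaOf (4 * p) K')⁻¹}) ×
        Matrix (Fin 2) (Fin 2) (IntermediateField.adjoin ℚ {zetaOf (8 * p) K'' - (zetaOf (8 * p) K'')⁻¹})) := inferInstance
    haveI : Module.Free ℚ (Matrix (Fin 2) (Fin 2) (IntermediateField.adjoin ℚ {zetaOf (4 * p) K' - (zetaOf (4 * p) K')⁻¹}) ×
        Matrix (Fin 2) (Fin 2) (IntermediateField.adjoin ℚ {zetaOf (8 * p) K'' - (zetaOf (8 * p) K'')⁻¹})) := inferInstance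
    haveI : Module.Finite ℚ (Matrix (Fin 2) (Fin 2) K ×
        (Matrix (Fin 2) (Fin 2) (IntermediateField.adjoin ℚ {zetaOf (4 * p) K' - (zetaOf (4 * p) K')⁻¹}) ×
          Matrix (Fin 2) (Fin 2) (IntermediateField.adjoin ℚ {zetaOf (8 * p) K'' - (zetaOf (8 * p) K'')⁻¹}))) := inferInstance
    haveI : Module.Free ℚ (Matrix (Fin 2) (Fin 2) K ×
        (Matrix (Fin 2) (Fin 2) (IntermediateField.adjoin ℚ {zetaOf (4 * p) K' - (zetaOf (4 * p) K')⁻¹}) ×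
          Matrix (Fin 2) (Fin 2) (IntermediateField.adjoin ℚ {zetaOf (8 * p) K'' - (zetaOf (8 * p) K'')⁻¹}))) := inferInstance
    haveI : Module.Finite ℚ (Matrix (Fin 2) (Fin 2) (IntermediateField.adjoin ℚ {zetaOf 8 K₈ - (zetaOf 8 K₈)⁻¹}) × (Matrix (Fin 2) (Fin 2) K ×
        (Matrix (Fin 2) (Fin 2) (IntermediateField.adjoin ℚ {zetaOf (4 * p) K' - (zetaOf (4 * p) K')⁻¹}) ×
          Matrix (Fin 2) (Fin 2) (IntermediateField.adjoin ℚ {zetaOf (8 * p) K'' - (zetaOf (8 * p) K'')⁻¹})))) := inferInstance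
    haveI : Module.Free ℚ (Matrix (Fin 2) (Fin 2) (IntermediateField.adjoin ℚ {zetaOf 8 K₈ - (zetaOf 8 K₈)⁻¹}) × (Matrix (Fin 2) (Fin 2) K ×
        (Matrix (Fin 2) (Fin 2) (IntermediateField.adjoin ℚ {zetaOf (4 * p) K' - (zetaOf (4 * p) K')⁻¹}) ×
          Matrix (Fin 2) (Fin 2) (IntermediateField.adjoin ℚ {zetaOf (8 * p) K'' - (zetaOf (8 * p) K'')⁻¹})))) := inferInstance
    rw [e.toLinearEquiv.finrank_eq, Module.finrank_prod, Module.finrank_prod, Module.finrank_prod, Module.finrank_prod,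
      Module.finrank_matrix, Module.finrank_matrix, Module.finrank_matrix, Module.finrank_matrix]
    simp only [Fintype.card_fin]
    rw [finrank_eq_two_four_e (K₄ := K₄), hK, hF₈, hF', hF'']
    omega
  · have hd₄ : A₄.dim = 1 := by
      have h : A₄.dim = finrank ℚ K₄ / 2 := Motives.schemeDim_eq_holds hA₄.1
      rw [finrank_eq_two_four_e (K₄ := K₄)] at h
      simpa using h
    have hd₈ : A₈.dim = 2 := by
      have h : A₈.dim = finrank ℚ K₈ / 2 := Motives.schemeDim_eq_holds hA₈.1
      rw [hK₈] at h
      simpa using h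
    have hd := dim_pair_odd_twiceOdd hodd h3 hΦ hA hΨ hA₂
    rw [Nat.totient_prime hp] at hd
    have hd' : A'.dim = p - 1 := by
      have h : A'.dim = finrank ℚ K' / 2 := Motives.schemeDim_eq_holds hA'.1
      rw [hK'] at h; omega
    have hd'' : A''.dim = 2 * (p - 1) := by
      have h : A''.dim = finrank ℚ K'' / 2 := Motives.schemeDim_eq_holds hA''.1
      rw [hK''] at h; omega
    rw [AbelianVariety.dim_biproduct, Fin.sum_univ_five]
    show A₄.dim + A₈.dim + (⨁ fun l : Fin 2 => (![A, A₂] : Fin 2 → AbelianVariety ℂ) l).dim + A'.dim + A''.dim = 4 * p - 1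
    omega

end EightTimesPrime

end HyperellipticJacobian

end Literature.AlgebraicGeometry.ComplexMultiplication

end
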